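import Summits.AtomisticToContinuum.FouriersLaw.Theses.EmbeddedDrudeMourre
import Summits.AtomisticToContinuum.FouriersLaw.Theorems.FGRGap.Negative.LoadBearing
import Literature.MathematicalPhysics.KineticTheory.PinnedChainResonantFinite

/-!
# FGRGap, line fold-jet-rigidity, stub S2 (averaging bootstrap) — file A:
# from `q(f) = 0` to the a.e. four-point identity

Support file for `stub_nullVectorRegularity` of crux `EmbeddedDrudeMourre.FGRGap`
(item stmt-AtomisticToContinuum-12595). Given the partner map `h` of the resonant set (two-root
structure off the diagonal, non-degenerate resolved Jacobian off the equal-velocity curve, joint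
measurability, double `2π`-periodicity) and the two null exceptional sets (equal-velocity curve,
vertex zero set), a `2π`-periodic measurable `f` with `boltzmannForm ω₂ a b f = 0` satisfies
`f k₁ + f (h k₁ k₃) = f k₃ + f (k₁ + h k₁ k₃ - k₃)` for Lebesgue-a.e. `(k₁, k₃) ∈ ℝ²`.
-/

noncomputable section

open MeasureTheory Set Real Filter Topology
open scoped ENNReal
open Literature.MathematicalPhysics.KineticTheory.PhononBoltzmann
open Summit.AtomisticToContinuum.FouriersLaw.Theorems.FGRGap

namespace Summit.AtomisticToContinuum.FouriersLaw.Theorems.FGRGap.FoldJetRigidity.Bootstrap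

/-! ## The pointwise shape of the resolved integrand on the cell -/

/-- Two points of the cell `(-π, π]` differing by a multiple of `2π` coincide. -/
theorem eq_of_mem_Ioc_of_sub_eq {k₁ k₃ : ℝ} (hk₁ : k₁ ∈ Ioc (-π) π) (hk₃ : k₃ ∈ Ioc (-π) π)
    {n : ℤ} (hn : k₃ - k₁ = n * (2 * π)) : k₁ = k₃ := by
  have h1 : (n : ℝ) * (2 * π) < 1 * (2 * π) := by
    rw [← hn]; linarith [hk₁.1, hk₁.2, hk₃.1, hk₃.2]
  have h2 : (-1 : ℝ) * (2 * π) < n * (2 * π) := by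
    rw [← hn]; linarith [hk₁.1, hk₁.2, hk₃.1, hk₃.2]
  have h1' : (n : ℝ) < 1 := lt_of_mul_lt_mul_right h1 (by positivity)
  have h2' : (-1 : ℝ) < n := lt_of_mul_lt_mul_right h2 (by positivity)
  have hn0 : n = 0 := by
    have a : n < 1 := by exact_mod_cast h1'
    have b : -1 < n := by exact_mod_cast h2'
    omega
  subst hn0
  simp only [Int.cast_zero, zero_mul, sub_eq_zero] at hn
  exact hn.symm

/-- Off the diagonal of the cell, `k₃ - k₁ ∉ 2πℤ`. -/
theorem forall_sub_ne_of_mem_Ioc {k₁ k₃ : ℝ} (hk₁ : k₁ ∈ Ioc (-π) π) (hk₃ : k₃ ∈ Ioc (-π) π)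
    (hne : k₁ ≠ k₃) : ∀ n : ℤ, k₃ - k₁ ≠ n * (2 * π) := fun _ hn =>
  hne (eq_of_mem_Ioc_of_sub_eq hk₁ hk₃ hn)

/-- On the cell, reduction modulo `2π` into `(-π, π]` is the identity. -/
theorem toIocMod_eq_self_of_mem {k : ℝ} (hk : k ∈ Ioc (-π) π) :
    toIocMod Real.two_pi_pos (-π) k = k := by
  rw [toIocMod_eq_self, show -π + 2 * π = π by ring]
  exact hk

/-- **Step 0 (pointwise identity).** Off the diagonal of the cell, the resolved integrand of
`q(f)` is the single term at the non-trivial partner `h k₁ k₃` (the exchange root `k₃` carries a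
vanishing bracket). -/
theorem finsum_resonant_eq {ω₂ a b : ℝ} (h : ℝ → ℝ → ℝ)
    (h_two : ∀ k₁ k₃ : ℝ, (∀ n : ℤ, k₃ - k₁ ≠ n * (2 * π)) →
      resonantSet ω₂ k₁ k₃ = {toIocMod Real.two_pi_pos (-π) k₃, h k₁ k₃})
    (f : ℝ → ℝ) {k₁ k₃ : ℝ} (hk₁ : k₁ ∈ Ioc (-π) π) (hk₃ : k₃ ∈ Ioc (-π) π) (hne : k₁ ≠ k₃) :
    (∑ᶠ k₂ ∈ resonantSet ω₂ k₁ k₃,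
        collisionWeight ω₂ a b k₁ k₂ k₃ * (f k₁ + f k₂ - f k₃ - f (k₁ + k₂ - k₃)) ^ 2) =
      collisionWeight ω₂ a b k₁ (h k₁ k₃) k₃ *
        (f k₁ + f (h k₁ k₃) - f k₃ - f (k₁ + h k₁ k₃ - k₃)) ^ 2 := by
  rw [h_two k₁ k₃ (forall_sub_ne_of_mem_Ioc hk₁ hk₃ hne), toIocMod_eq_self_of_mem hk₃]
  by_cases hh : h k₁ k₃ = k₃
  · rw [hh, Set.pair_eq_singleton, finsum_mem_singleton]
  · rw [finsum_mem_pair (Ne.symm hh)]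
    simp

/-! ## Measurability of the resolved integrand along the partner map -/

/-- The pinned band and its group velocity are measurable functions of the momentum. -/
theorem measurable_dispersion_groupVelocity (ω₂ : ℝ) :
    Measurable (dispersion ω₂) ∧ Measurable (groupVelocity ω₂) := by
  have hc : Continuous (dispersion ω₂) := by unfold dispersion; fun_prop
  refine ⟨hc.measurable, ?_⟩
  unfold groupVelocity
  exact Real.continuous_sin.measurable.div hc.measurable

/-- The collision weight is a jointly measurable function of its three momenta. -/
theorem measurable_collisionWeight (ω₂ a b : ℝ) :
    Measurable (fun q : ℝ × ℝ × ℝ => collisionWeight ω₂ a b q.1 q.2.1 q.2.2) := by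
  obtain ⟨hd, hv⟩ := measurable_dispersion_groupVelocity ω₂
  have h1 : Measurable fun q : ℝ × ℝ × ℝ => q.1 := measurable_fst
  have h2 : Measurable fun q : ℝ × ℝ × ℝ => q.2.1 := measurable_fst.comp measurable_snd
  have h3 : Measurable fun q : ℝ × ℝ × ℝ => q.2.2 := measurable_snd.comp measurable_snd
  have h4 : Measurable fun q : ℝ × ℝ × ℝ => q.1 + q.2.1 - q.2.2 := (h1.add h2).sub h3
  have hV : Measurable fun q : ℝ × ℝ × ℝ => vertex a b q.1 q.2.1 q.2.2 := by
    have : Continuous fun q : ℝ × ℝ × ℝ => vertex a b q.1 q.2.1 q.2.2 := by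
      unfold vertex; fun_prop
    exact this.measurable
  have hJ : Measurable fun q : ℝ × ℝ × ℝ => resonanceJacobian ω₂ q.1 q.2.1 q.2.2 := by
    unfold resonanceJacobian
    exact continuous_abs.measurable.comp ((hv.comp h2).sub (hv.comp h4))
  have hD : Measurable fun q : ℝ × ℝ × ℝ => (dispersion ω₂ q.1 * dispersion ω₂ q.2.1 *
      dispersion ω₂ q.2.2 * dispersion ω₂ (q.1 + q.2.1 - q.2.2)) ^ 2 :=
    ((((hd.comp h1).mul (hd.comp h2)).mul (hd.comp h3)).mul (hd.comp h4)).pow_const 2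
  unfold collisionWeight
  exact ((measurable_const.mul (hV.pow_const 2)).div hD).div hJ

/-- The resolved integrand along a jointly measurable partner map is jointly measurable. -/
theorem measurable_weight_bracket (ω₂ a b : ℝ) {h : ℝ → ℝ → ℝ}
    (h_meas : Measurable (Function.uncurry h)) {f : ℝ → ℝ} (hf : Measurable f) :
    Measurable (fun p : ℝ × ℝ => collisionWeight ω₂ a b p.1 (h p.1 p.2) p.2 *
      (f p.1 + f (h p.1 p.2) - f p.2 - f (p.1 + h p.1 p.2 - p.2)) ^ 2) := by
  have hH : Measurable (fun p : ℝ × ℝ => h p.1 p.2) := h_meas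
  have hg : Measurable (fun p : ℝ × ℝ => (p.1, h p.1 p.2, p.2)) :=
    measurable_fst.prodMk (hH.prodMk measurable_snd)
  have hw := (measurable_collisionWeight ω₂ a b).comp hg
  simp only [Function.comp_def] at hw
  have h1 : Measurable (fun p : ℝ × ℝ => f p.1) := hf.comp measurable_fst
  have h2 : Measurable (fun p : ℝ × ℝ => f (h p.1 p.2)) := hf.comp hH
  have h3 : Measurable (fun p : ℝ × ℝ => f p.2) := hf.comp measurable_snd
  have h4 : Measurable (fun p : ℝ × ℝ => f (p.1 + h p.1 p.2 - p.2)) :=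
    hf.comp ((measurable_fst.add hH).sub measurable_snd)
  have h5 : Measurable (fun p : ℝ × ℝ =>
      (f p.1 + f (h p.1 p.2) - f p.2 - f (p.1 + h p.1 p.2 - p.2)) ^ 2) :=
    (((h1.add h2).sub h3).sub h4).pow_const 2
  exact hw.mul h5

/-! ## Where the weight vanishes -/

/-- The collision weight at the partner vanishes only on the vertex zero set or where the
resolved Jacobian degenerates. -/
theorem collisionWeight_eq_zero_iff {ω₂ : ℝ} (hω : 0 < ω₂) (a b k₁ k₂ k₃ : ℝ) :
    collisionWeight ω₂ a b k₁ k₂ k₃ = 0 ↔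
      vertex a b k₁ k₂ k₃ = 0 ∨ groupVelocity ω₂ k₂ = groupVelocity ω₂ (k₁ + k₂ - k₃) := by
  have hD : (dispersion ω₂ k₁ * dispersion ω₂ k₂ * dispersion ω₂ k₃ *
      dispersion ω₂ (k₁ + k₂ - k₃)) ^ 2 ≠ 0 := by
    have := dispersion_pos hω k₁
    have := dispersion_pos hω k₂
    have := dispersion_pos hω k₃
    have := dispersion_pos hω (k₁ + k₂ - k₃)
    positivity
  have hA : alsPrefactor ≠ 0 := alsPrefactor_pos.ne'
  unfold collisionWeight resonanceJacobian
  rw [div_eq_zero_iff, div_eq_zero_iff, abs_eq_zero, sub_eq_zero, mul_eq_zero]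
  constructor
  · rintro (((h | h) | h) | h)
    · exact absurd h hA
    · exact Or.inl (pow_eq_zero_iff two_ne_zero |>.1 h)
    · exact absurd h hD
    · exact Or.inr h
  · rintro (h | h)
    · exact Or.inl (Or.inl (Or.inr (by rw [h]; ring)))
    · exact Or.inr h

/-! ## Step 1: from `q(f) = 0` to the a.e. identity -/

/-- The double `2π`-periodicity of the four-point bracket along a doubly periodic partner map. -/
theorem bracket_sub_period {h : ℝ → ℝ → ℝ}
    (h_per : ∀ k₁ k₃ : ℝ, h (k₁ + 2 * π) k₃ = h k₁ k₃ ∧ h k₁ (k₃ + 2 * π) = h k₁ k₃)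
    {f : ℝ → ℝ} (hf_per : Function.Periodic f (2 * π)) (m n : ℤ) (p : ℝ × ℝ) :
    f (p.1 - m * (2 * π)) + f (h (p.1 - m * (2 * π)) (p.2 - n * (2 * π))) -
        f (p.2 - n * (2 * π)) -
        f (p.1 - m * (2 * π) + h (p.1 - m * (2 * π)) (p.2 - n * (2 * π)) - (p.2 - n * (2 * π))) =
      f p.1 + f (h p.1 p.2) - f p.2 - f (p.1 + h p.1 p.2 - p.2) := by
  have hp1 : Function.Periodic (fun x => h x (p.2 - n * (2 * π))) (2 * π) := fun x =>
    (h_per x _).1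
  have hp2 : Function.Periodic (fun y => h p.1 y) (2 * π) := fun y => (h_per p.1 y).2
  have e1 : h (p.1 - m * (2 * π)) (p.2 - n * (2 * π)) = h p.1 p.2 := by
    rw [hp1.sub_int_mul_eq m, hp2.sub_int_mul_eq n]
  rw [e1, hf_per.sub_int_mul_eq m, hf_per.sub_int_mul_eq n,
    show p.1 - m * (2 * π) + h p.1 p.2 - (p.2 - n * (2 * π)) =
      p.1 + h p.1 p.2 - p.2 - m * (2 * π) + n * (2 * π) by ring,
    hf_per.int_mul n, hf_per.sub_int_mul_eq m]

/-- The non-vanishing set of a doubly `2π`-periodic function on the plane is null as soon as it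
is null inside the cell square (the plane is covered by the `2πℤ²`-translates of the cell
square, and Lebesgue measure is translation invariant). -/
theorem null_of_null_inter_cell_sq {B : ℝ × ℝ → ℝ}
    (hB : ∀ (m n : ℤ) (p : ℝ × ℝ), B (p.1 - m * (2 * π), p.2 - n * (2 * π)) = B p)
    (h0 : volume ({p : ℝ × ℝ | B p ≠ 0} ∩ Ioc (-π) π ×ˢ Ioc (-π) π) = 0) :
    volume {p : ℝ × ℝ | B p ≠ 0} = 0 := by
  set S : Set (ℝ × ℝ) := {p : ℝ × ℝ | B p ≠ 0} with hS
  have hcover : S ⊆ ⋃ m : ℤ, ⋃ n : ℤ,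
      (fun p : ℝ × ℝ => p + (-((m : ℝ) * (2 * π)), -((n : ℝ) * (2 * π)))) ⁻¹'
        (S ∩ Ioc (-π) π ×ˢ Ioc (-π) π) := by
    intro p hp
    simp only [mem_iUnion, mem_preimage]
    set m : ℤ := toIocDiv Real.two_pi_pos (-π) p.1 with hm
    set n : ℤ := toIocDiv Real.two_pi_pos (-π) p.2 with hn
    have he : p + (-((m : ℝ) * (2 * π)), -((n : ℝ) * (2 * π))) =
        (p.1 - m * (2 * π), p.2 - n * (2 * π)) := by
      ext <;> simp [sub_eq_add_neg]
    refine ⟨m, n, ?_, ?_⟩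
    · show B _ ≠ 0
      rw [he, hB]
      exact hp
    · have h1 := toIocMod_mem_Ioc Real.two_pi_pos (-π) p.1
      have h2 := toIocMod_mem_Ioc Real.two_pi_pos (-π) p.2
      rw [← self_sub_toIocDiv_zsmul, zsmul_eq_mul, show -π + 2 * π = π by ring] at h1 h2
      rw [he]
      exact ⟨h1, h2⟩
  refine measure_mono_null hcover (measure_iUnion_null fun m => measure_iUnion_null fun n => ?_)
  rw [measure_preimage_add_right]
  exact h0

/-- **Step 1 (the a.e. identity).** Let `h` be a partner map with the two-root property off the
diagonal, non-degenerate resolved Jacobian off the equal-velocity curve, joint measurability and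
double `2π`-periodicity, and assume the equal-velocity curve and the vertex zero set are null.
If `f` is `2π`-periodic measurable with `q(f) = 0`, then
`f k₁ + f (h k₁ k₃) = f k₃ + f (k₁ + h k₁ k₃ - k₃)` for a.e. `(k₁, k₃) ∈ ℝ²`. -/
theorem ae_bracket_eq_zero {ω₂ a b : ℝ} (hω : 0 < ω₂) {h : ℝ → ℝ → ℝ}
    (h_per : ∀ k₁ k₃ : ℝ, h (k₁ + 2 * π) k₃ = h k₁ k₃ ∧ h k₁ (k₃ + 2 * π) = h k₁ k₃)
    (h_two : ∀ k₁ k₃ : ℝ, (∀ n : ℤ, k₃ - k₁ ≠ n * (2 * π)) →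
      resonantSet ω₂ k₁ k₃ = {toIocMod Real.two_pi_pos (-π) k₃, h k₁ k₃})
    (h_jac : ∀ k₁ k₃ : ℝ, groupVelocity ω₂ k₃ ≠ groupVelocity ω₂ k₁ →
      groupVelocity ω₂ (h k₁ k₃) ≠ groupVelocity ω₂ (k₁ + h k₁ k₃ - k₃))
    (h_meas : Measurable (Function.uncurry h))
    (hC2 : volume {p : ℝ × ℝ | groupVelocity ω₂ p.2 = groupVelocity ω₂ p.1} = 0)
    (hC3 : volume {p : ℝ × ℝ | vertex a b p.1 (h p.1 p.2) p.2 = 0} = 0)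
    {f : ℝ → ℝ} (hf_per : Function.Periodic f (2 * π)) (hf_meas : Measurable f)
    (hq : boltzmannForm ω₂ a b f = 0) :
    ∀ᵐ p : ℝ × ℝ, f p.1 + f (h p.1 p.2) = f p.2 + f (p.1 + h p.1 p.2 - p.2) := by
  -- notation
  set B : ℝ × ℝ → ℝ := fun p => f p.1 + f (h p.1 p.2) - f p.2 - f (p.1 + h p.1 p.2 - p.2)
    with hB
  set T : ℝ × ℝ → ℝ := fun p => collisionWeight ω₂ a b p.1 (h p.1 p.2) p.2 * B p ^ 2 with hT
  have hTm : Measurable T := measurable_weight_bracket ω₂ a b h_meas hf_meas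
  set μc : Measure ℝ := volume.restrict (Ioc (-π) π) with hμc
  -- the iterated integral vanishes
  have hq' : ∫⁻ k₁ in Ioc (-π) π, ∫⁻ k₃ in Ioc (-π) π, ENNReal.ofReal (T (k₁, k₃)) = 0 := by
    unfold boltzmannForm at hq
    have h4 : ENNReal.ofReal (1 / 4) ≠ 0 := by simp
    have hq0 := (mul_eq_zero.1 hq).resolve_left h4
    rw [← hq0]
    refine setLIntegral_congr_fun measurableSet_Ioc fun k₁ hk₁ => ?_
    refine lintegral_congr_ae ((ae_restrict_iff' measurableSet_Ioc).2 ?_)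
    have hne : ∀ᵐ k₃ ∂(volume : Measure ℝ), k₃ ≠ k₁ := by
      rw [ae_iff]
      simp
    filter_upwards [hne] with k₃ hk₃ hk₃c
    rw [hT, hB]
    simp only
    rw [finsum_resonant_eq h h_two f hk₁ hk₃c (Ne.symm hk₃)]
  -- hence `T = 0` a.e. on the cell square
  have hG : Measurable fun k₁ => ∫⁻ k₃ in Ioc (-π) π, ENNReal.ofReal (T (k₁, k₃)) :=
    (hTm.ennreal_ofReal).lintegral_prod_right' (ν := μc)
  have h1 : ∀ᵐ k₁ ∂μc, ∀ᵐ k₃ ∂μc, ENNReal.ofReal (T (k₁, k₃)) = 0 := by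
    have := (lintegral_eq_zero_iff hG).1 hq'
    filter_upwards [this] with k₁ hk₁
    have hm : Measurable fun k₃ => ENNReal.ofReal (T (k₁, k₃)) :=
      (hTm.comp (measurable_const.prodMk measurable_id)).ennreal_ofReal
    exact (lintegral_eq_zero_iff hm).1 hk₁
  have h2 : ∀ᵐ p ∂(μc.prod μc), ENNReal.ofReal (T p) = 0 := by
    rw [Measure.ae_prod_iff_ae_ae]
    · exact h1
    · exact hTm.ennreal_ofReal (measurableSet_singleton 0)
  have h3 : ∀ᵐ p : ℝ × ℝ, p ∈ Ioc (-π) π ×ˢ Ioc (-π) π → T p ≤ 0 := by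
    rw [hμc, Measure.prod_restrict, ← Measure.volume_eq_prod] at h2
    rw [← ae_restrict_iff' (measurableSet_Ioc.prod measurableSet_Ioc)]
    filter_upwards [h2] with p hp
    exact ENNReal.ofReal_eq_zero.1 hp
  -- off the two null sets the weight is positive, so the bracket vanishes
  have h4 : ∀ᵐ p : ℝ × ℝ, p ∈ Ioc (-π) π ×ˢ Ioc (-π) π → B p = 0 := by
    filter_upwards [h3, measure_eq_zero_iff_ae_notMem.1 hC2,
      measure_eq_zero_iff_ae_notMem.1 hC3] with p hp hp2 hp3 hpc
    have hle := hp hpc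
    have hw0 : 0 ≤ collisionWeight ω₂ a b p.1 (h p.1 p.2) p.2 := collisionWeight_nonneg _ _ _ _ _ _
    have hT0 : T p = 0 := le_antisymm hle (by rw [hT]; positivity)
    rcases mul_eq_zero.1 hT0 with hw | hb
    · rcases (collisionWeight_eq_zero_iff hω a b _ _ _).1 hw with hv | hj
      · exact absurd hv hp3
      · exfalso
        have hne : groupVelocity ω₂ p.2 ≠ groupVelocity ω₂ p.1 := hp2
        exact h_jac p.1 p.2 hne hj
    · exact pow_eq_zero_iff two_ne_zero |>.1 hb
  -- periodicity spreads the identity over the plane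
  have h5 : volume {p : ℝ × ℝ | B p ≠ 0} = 0 := by
    refine null_of_null_inter_cell_sq (B := B) (fun m n p => ?_) ?_
    · simp only [hB]
      exact bracket_sub_period h_per hf_per m n p
    · rw [measure_eq_zero_iff_ae_notMem]
      filter_upwards [h4] with p hp hpS
      exact hpS.1 (hp hpS.2)
  have h6 := measure_eq_zero_iff_ae_notMem.1 h5
  filter_upwards [h6] with p hp
  have : B p = 0 := by simpa using hp
  rw [hB] at this
  simp only at this
  linarith

end Summit.AtomisticToContinuum.FouriersLaw.Theorems.FGRGap.FoldJetRigidity.Bootstrap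

namespace Summit.AtomisticToContinuum.FouriersLaw.Theorems.FGRGap.FoldJetRigidity

/-- **Helper stub A of `stub_nullVectorRegularity` (line fold-jet-rigidity).** From `q(f) = 0` to
the a.e. four-point identity along the partner map `h`: given the two-root structure off the
diagonal, the non-degenerate resolved Jacobian off the equal-velocity curve, joint measurability
and double periodicity of `h`, and the two null exceptional sets, a `2π`-periodic measurable `f`
with `boltzmannForm ω₂ a b f = 0` satisfies `f k₁ + f (h k₁ k₃) = f k₃ + f (k₁ + h k₁ k₃ - k₃)`
for Lebesgue-a.e. `(k₁, k₃) ∈ ℝ²`. -/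
theorem stub_nullVectorRegularity_partA :
    ∀ ω₂ a b : ℝ, 0 < ω₂ → ∀ h : ℝ → ℝ → ℝ, (∀ k₁ k₃ : ℝ, h (k₁ + 2 * π) k₃ = h k₁ k₃ ∧ h k₁ (k₃ + 2 * π) = h k₁ k₃) → (∀ k₁ k₃ : ℝ, (∀ n : ℤ, k₃ - k₁ ≠ n * (2 * π)) → resonantSet ω₂ k₁ k₃ = {toIocMod Real.two_pi_pos (-π) k₃, h k₁ k₃}) → (∀ k₁ k₃ : ℝ, groupVelocity ω₂ k₃ ≠ groupVelocity ω₂ k₁ → groupVelocity ω₂ (h k₁ k₃) ≠ groupVelocity ω₂ (k₁ + h k₁ k₃ - k₃)) → Measurable (Function.uncurry h) → MeasureTheory.volume {p : ℝ × ℝ | groupVelocity ω₂ p.2 = groupVelocity ω₂ p.1} = 0 → MeasureTheory.volume {p : ℝ × ℝ | vertex a b p.1 (h p.1 p.2) p.2 = 0} = 0 → ∀ f : ℝ → ℝ, Function.Periodic f (2 * π) → Measurable f → boltzmannForm ω₂ a b f = 0 → ∀ᵐ p : ℝ × ℝ, f p.1 + f (h p.1 p.2) = f p.2 + f (p.1 +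 h p.1 p.2 - p.2) :=
  fun _ω₂ _a _b hω _h h_per h_two h_jac h_meas hC2 hC3 _f hf_per hf_meas hq =>
    Bootstrap.ae_bracket_eq_zero hω h_per h_two h_jac h_meas hC2 hC3 hf_per hf_meas hq

end Summit.AtomisticToContinuum.FouriersLaw.Theorems.FGRGap.FoldJetRigidity

end
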